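import Literature.MathematicalPhysics.QuantumFieldTheory.Balaban1983to89.B9Cor36GCubeLocDefectTransfer
import Literature.MathematicalPhysics.QuantumFieldTheory.Balaban1983to89.B9Thm37TransposedCommutator

/-!
# NODE 00 — THE TWO LOCAL-INVERSE LAWS OF (3.87)–(3.88) AT PRINT's SEQUENCE LETTER `G′_□(U)` ( = r05 `GpCubeY i □ par U`, the (R)-design's
# operator of the cube's own sequence `{Ω_n(□)}`), READ AT THE MEMBER's FIELD `U` ITSELF: `h·Δ′_a(U)·G′_□(U)·h = h² = h·G′_□(U)·Δ′_a(U)·h` for every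
# real cut-off `h` supported near `□` and for the partition of record `h_□ = hTY i □`, from `IsUnit Δ′_{a,□}(U)` ALONE (any transporter `par`) —
# hence (3.88), its transpose and the fixed point (3.90) at these letters (walk-letter instance, FILE A-0′ = the sequence-letter twin of FILE A-0
# `Node00.OpsYLocalInverse`)

T. Bałaban, *Propagators for lattice gauge theories in a background field*, Commun. Math. Phys. **99** (1985) 389–434
[`Balaban1985BackgroundPropagators`, "B9"]; [4] = T. Bałaban, *Propagators and renormalization transformations for lattice gauge
theories. II*, Commun. Math. Phys. **96** (1984) 223–250 [`Balaban1984PropagatorsII`].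

statement-level skeleton of published theorems with citation tags; proofs where landed; nothing here is a claim about the
Yang–Mills mass gap

THE PRINTED LOCUS (verbatim, held `paper:balaban1985-cmp99-background-propagators`, journal page = PDF page + 388).  p. 408 l. 35 – p. 409 l. 5:
*«Let us take a cube □ ∈ 𝒟_j and let us define a sequence {Ω_n(□)}_{n=0,…,j+1} of domains … This sequence satisfies the conditions (2.1), (2.2) …
hence Ω₀(□) ⊂ □̃⁵ … the sequence {Ω_n(□)} satisfies the assumptions of Corollary 3.6. The operators constructed for this sequence, which we denote by
G′_□(U), C_□(U) = (Q′(U)G′_□²(U)Q′\*(U))⁻¹, G_□(U), satisfy all the inequalities of Theorems 3.1-3.3 correspondingly»*; p. 409 (3.87) *«G′₀ = Σ_{□∈𝒟}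
h_□G′_□h_□»*, (3.88) *«(Δ′_a hλ)(x) = h(x)(Δ′_aλ)(x) − (K(h)λ)(x), hence Δ′_aG′₀ = I − Σ_□ K(h_□)G′_□h_□ = I − R′»* — print's «hence» inverts
`Δ′_a(U)` by `G′_□(U)` ON THE ROWS WHERE `h_□` LIVES: for the Dirichlet `G′_□` a one-sided `Δ′_aG′_□h_□λ = h_□λ` would hold only on rows whose stencil stays
inside `Ω₀(□)`, which is why the law actually used (by print's computation with `Σ_□ h_□² = 1`, and typed here) is the TWO-SIDED `h_□Δ′_aG′_□h_□ = h_□²`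
(v1.1, ref-F g40 READ-903 NIT-1); (3.90) *«G′ = G′₀(I − R′)⁻¹ = G′₀ Σ_n R′ⁿ»*; p. 410 l. 14–15
*«A propagator G′_□ depends on U restricted to Ω₀(□) ⊂ □̃⁵ and the operator K(h) is semi-local»*.

(v1.1, 2026-08-30: doc-only — the (3.88) gloss above made two-sided per ref-F g40 READ-903 NIT-1; declarations byte-identical to v1.0 ✓p764014.)

WHY THIS FILE (NODE 00 ruling WORD-79, fleet INBOX 2026-08-30T05:44:48Z, on dag-n06-c's LOCATED-26).  In the tree, print's `G′_□(U)` — the Sect.-A operator of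
the CUBE's OWN SEQUENCE — is lit-balaban-r05's `B9CubeLettersOpsL0.GpCubeY i □ par U = (Δ′_{a,□}(U))⁻¹` (the (R)-design: `Ω₀(□) := 𝕋` with a mass floor instead of
print's Dirichlet exterior), whose ROWS agree with the member's `Δ′_a(U)` near `□` (`deltaPrimeACubeY_apply_eq_of_nearH`: «(Δ′_{a,□}(U)Λ)(z) = (Δ′_a(U)Λ)(z) for
z ∈ NearH □»).  The walk-letter instance of record (dag-n06-d's `B9WalkLettersCoordsS.opsWalkY`, slot `Gsq`) is at present keyed on FILE A-0's `GsqY` — the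
□̃-DIRICHLET COMPRESSION of the member's global `Δ′_a(U)`, a local inverse in the (3.88) sense but NOT the object for which Cor. 3.6 prints (3.42) (a Dirichlet face
adjacent to level-`j` averaging lies outside Thms 3.1–3.3; NODE 00 erratum LOCATED-27 on that file's docstring).  ROAD (a) of the ruling re-keys the slot to a cube
letter for which (3.42) is available; the (3.88) layer is ALREADY ABSTRACT over cube-letter families carrying the two local-inverse laws as HYPOTHESES (n06-l ∕ p38
`B9Thm37CubeCoverCommutators.eq388_deltaPrimeAY`, `fixedPoint388_deltaPrimeAY`, `B9Thm37TransposedCommutator.eq388T_hT`; p21's consumer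
`B9Thm37GpTorusRegularFinal.eBlock_kernelFamilySInv_Gp_of_localInverse` with binders `hloc`, `hlocT`, `hE` per cube).  THIS FILE discharges `hloc` AND `hlocT` for the
family `Oc □ := GpCubeY i □ par` READ AT THE MEMBER's FIELD `U` — print's literal «G′_□(U)» — from `IsUnit Δ′_{a,□}(U)` alone, for ANY site transporter `par` (no gauge
law, no (3.35) datum, no localised field):
* §1 ROW SIDE (`hloc`): `M_h·Δ′_a(U) = M_h·Δ′_{a,□}(U)` for `supp h ⊆ NearH □` (r05's row agreement as an operator identity) ⇒ ★★ `M_h·Δ′_a(U)·G′_□(U)·M_h = M_h²`.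
* §2 COLUMN SIDE (`hlocT`): `Δ′_a(U)·M_h = Δ′_{a,□}(U)·M_h` as soon as every site whose `K(h)`-stencil meets `supp h` is near `□` (a row of either product at `z`
  vanishes unless `stencil(z)` meets `supp h` — p38's `stencilY`; this is lit-balaban-p33's row identity `B9Cor36GpCubeLocLetter.cutMulY_deltaPrimeAY_cutMulY_eq'`
  at `χ := 1`, `U′ = Ṽ := U`, used BY NAME) ⇒ ★★ `M_h·G′_□(U)·Δ′_a(U)·M_h = M_h²`.
* §3 AT THE PARTITION OF RECORD `h_□ = hTY i □` (p38; print's «{h_□} defined at the end of Sect. A in [4]»): both laws with NO hypothesis beyond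
  `IsUnit Δ′_{a,□}(U)` — the support geometry `supp h_□ ⊂ NearC_□(S_j)`, `stencil⁻¹(supp h_□) = D_□ ⊂ NearH □` is lit-balaban's `B9Cor36CubeCutoffs` §1–§2
  (`nearC_of_hT_ne_zero`, `DthY`, `mem_DthY`, `nearH_of_mem_DthY`; `supp h_□ ⊂ NearH □` itself is p33's landed
  `B9Cor36GCubeLocDefectTransfer.nearH_of_hTY_ne_zero`), used BY NAME: ★★★ `localInverse_laws_hTY_GpCubeY` = the consumer's `hloc` ∧ `hlocT` at
  `Oc □ := GpCubeY i □ par`, letter-exact.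
* §4 (3.87)–(3.88), THE TRANSPOSED (3.88) AND THE FIXED POINT (3.90) AT THESE LETTERS, for general cut-off families (`Σ_c h_c² = 1`, supports near their cubes) and
  at the partition of record; ★ `GpY_eq_fixedPoint388_GpCubeY`: def-Y's member inverse `G′(U) = GpY i par U` satisfies `G′ = Σ_□ h_□G′_□h_□ + G′·R′` with print's
  `R′ = Σ_□ K(h_□)G′_□h_□` at the sequence letters, under `IsUnit Δ′_a(U)` and `∀ □, IsUnit Δ′_{a,□}(U)`.

HONEST SCOPE ∕ NOT CLAIMED.  Finite-dimensional operator algebra over def-Y's and r05's DEFINED operators plus lit-balaban's landed support geometry; every proof is a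
few lines of rewriting BY NAME.  `IsUnit Δ′_{a,□}(U)` (the regime's positivity (3.36) for the cube sequence — Thm 3.1 ∕ Cor. 3.6 territory) and `IsUnit Δ′_a(U)` are
HYPOTHESES, never asserted (inhabited at `U = 1` by r05's `B9Cor35GpCubeInputsAtOne` lineage — not a vacuous schema).  NOT supplied here and NOT claimed: the (3.42)
block `hE` for `GpCubeY i □ par U` at the member's raw field `U` — in the tree Cor. 3.6's (3.42) is proved for the (R)-letter read at a LOCALISED (3.37)-small field
`Ṽ_□` and transported back (lit-balaban-p33's `B9Cor36GpCubeLocLetter.locLetterY`, all three binders discharged from per-cube (3.35) data by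
`B9Cor36GpCoverBinders.gpLoc_cover_binders`; design findings (F1)∕(F2) of that module: the (R)-letter reads its field on the whole member torus, where `U^u` is not
small), so a consumer wanting `hE` from the tree today takes `Oc □ := locLetterY …`; the present file is the datum-free, print-literal inhabitant of `hloc`∕`hlocT` and
of the (3.88)∕(3.90) identities, which need no smallness.  DESIGN DEVIATION displayed as in r05's file: `Ω₀(□) := 𝕋` (mass floor `a·L⁻²·(levels)` outside the
multiscale region instead of Dirichlet data on `Ω₀(□)ᶜ`).  Count-neutral; no summit ∕ sub-problem statement is proved; N06 NOT discharged; nothing continuum ∕ OS ∕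
mass-gap ∕ Clay.  No `sorry`, no `axiom`, no `… : Prop` fact, no `instance`, no `notation`, no `def`.  NEW file; nothing landed is modified.  Cell `pub-ymgap`, seat
`node00-def-Y` gen 30, 2026-08-30; `--supports stmt-QuantumFields-20541`.  Net new unproved facts: 0.

RELATED IN THE TREE, NOT DUPLICATED (searched 2026-08-30: `rg 'cutMulY .* GpCubeY i . [a-z]* U \* deltaPrimeAY|deltaPrimeAY i [a-z]* U \* GpCubeY'` over
`Balaban1983to89/` = ∅ at the member's field; `lean search 'OpsYLocalInverseSeq|localInverse_laws_hTY_GpCubeY'` = ∅).  lit-balaban-p33 `B9Cor36GpCubeLocLetter` (§2 row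
identities for a general localised∕transported∕cut-off letter `χR(u)⁻¹G′_□(Ṽ)R(u)χ`, §3 `localInverse_laws_of_agree` — needs `IsGaugeLawS`∕`ParLocalY`; the present
laws are its `u := 1, Ṽ := U, χ := 1` point for ARBITRARY `par`, obtained from §2's row identity directly, no transporter law) and `B9Cor36CubeCutoffs` (§2 support
geometry of `h_□`; §4 `localInverse_laws_hTY_parSymY` = the laws for `locLetterY` at `parSymY` from a (3.35) datum), `B9Cor36GCubeLocDefectTransfer`
(`nearH_of_hTY_ne_zero`, imported for that one lemma — the gate's dedup rule) — USED BY NAME; r05 `B9CubeLettersOpsL0`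
(`GpCubeY`, row agreement, inverse laws), `B9CubeSequence408.NearH`; p38∕n06-l `B9Thm37CubeCoverCommutators` (`cutMulY`, `KhY`, `stencilY`, `hTY`, (3.88) and (3.90)
over abstract families), `B9Thm37TransposedCommutator.eq388T_hT` — USED BY NAME; def-Y `Node00.OpsYLocalInverse` (`GsqY`, `eq388_GsqY`, `fixedPoint388_GsqY`: the
COMPRESSION letters — the alternative inhabitant, not touched), `Node00.OpsYDeltaPrimeA` (`GpY`, `GpY_mul_deltaPrimeAY`); dag-n06-c `B9Local342OfEBlockInv` (the
(3.42)-currency bridge `EBlock ⟹ Local342` shapes, generic in the letter — the consumer side of road (a), not imported here).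
-/

noncomputable section

namespace Literature.MathematicalPhysics.QuantumFieldTheory.Balaban1983to89.Node00.OpsYLocalInverseSeq

open B6KLevelCensusIndexV1 (KIdx)
open B6Cover236MultiLevelBlocks (cubes)
open B9CubeSequence408 (NearH)
open B9CubeLettersOpsL0 (deltaPrimeACubeY GpCubeY cutoff_deltaPrimeACubeY_eq deltaPrimeACubeY_mul_GpCubeY GpCubeY_mul_deltaPrimeACubeY)
open B9Thm37CubeCoverCommutators (cutMulY cutMulY_apply cutMulY_one sum_cutMulY_mul_self stencilY KhY deltaPrimeAY_mul_cutMulY hTY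
  eq388_deltaPrimeAY fixedPoint388_deltaPrimeAY eq388_hT fixedPoint388_hT)
open B9Thm37TransposedCommutator (eq388T_sum eq388T_hT)
open B9Cor36GpCubeLocLetter (cutMulY_deltaPrimeAY_cutMulY_eq')
open B9Cor36CubeCutoffs (DthY mem_DthY nearH_of_mem_DthY)
open B9Cor36GCubeLocDefectTransfer (nearH_of_hTY_ne_zero)

variable {d ℓ : ℕ} {hd : 1 ≤ d + 1} {hL : Odd (ℓ + 1) ∧ 1 < ℓ + 1} {b₀ b₁ : ℝ}
variable {𝔸 : Type} [NormedRing 𝔸] [NormedAlgebra ℂ 𝔸] [CompleteSpace 𝔸]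
variable (i : KIdx d ℓ hd hL b₀ b₁)

/-! ## §1 Row side: `M_h·Δ′_a(U) = M_h·Δ′_{a,□}(U)` near □, hence `hloc` at `G′_□(U)` -/

section Rows

variable (q : ↥(cubes (toKT i).D.toDomains)) (par : SiteParY 𝔸 i)

/-- ★ ROW AGREEMENT AS AN OPERATOR IDENTITY: `M_h·Δ′_a(U) = M_h·Δ′_{a,□}(U)` for a real cut-off `h` supported near □ (r05's `cutoff_deltaPrimeACubeY_eq`
read in `End_ℂ(SiteY i → 𝔸)`). [cite: Balaban1985BackgroundPropagators, (3.88) p.409, (3.24) p.394, p.410 l.14–15] -/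
theorem cutMulY_mul_deltaPrimeAY_eq (U : CfgY 𝔸 i) (h : SiteY i → ℝ) (hh : ∀ z, h z ≠ 0 → NearH q z.1) :
    cutMulY h * deltaPrimeAY i par U = cutMulY h * deltaPrimeACubeY i q par U := by
  refine LinearMap.ext fun Λ => funext fun z => ?_
  rw [Module.End.mul_apply, Module.End.mul_apply, cutMulY_apply, cutMulY_apply]
  exact (congrFun (cutoff_deltaPrimeACubeY_eq i q par U h hh Λ) z).symm

/-- ★★ **`hloc` AT PRINT's `G′_□(U)`**: for every real cut-off `h` supported near □ and `Δ′_{a,□}(U)` invertible, `M_h·Δ′_a(U)·G′_□(U)·M_h = M_h²` — the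
hypothesis `hloc` of `B9Thm37CubeCoverCommutators.eq388_deltaPrimeAY` ∕ `B9Thm37GpTorusRegularFinal.eBlock_kernelFamilySInv_Gp_of_localInverse` at
`Oc □ := GpCubeY i □ par`, read at the member's own field (print: «Δ′_aG′₀ = I − Σ_□ K(h_□)G′_□h_□» uses exactly `Δ′_aG′_□h_□ = h_□`).
[cite: Balaban1985BackgroundPropagators, (3.87)–(3.88) p.409, p.408 l.35–p.409 l.5 (G′_□(U))] -/
theorem cutMulY_deltaPrimeAY_GpCubeY_cutMulY {U : CfgY 𝔸 i} (hU : IsUnit (deltaPrimeACubeY i q par U))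
    (h : SiteY i → ℝ) (hh : ∀ z, h z ≠ 0 → NearH q z.1) :
    cutMulY h * deltaPrimeAY i par U * GpCubeY i q par U * cutMulY h = cutMulY h * cutMulY h := by
  rw [cutMulY_mul_deltaPrimeAY_eq i q par U h hh, mul_assoc (cutMulY h) (deltaPrimeACubeY i q par U) (GpCubeY i q par U),
    deltaPrimeACubeY_mul_GpCubeY i q par U hU, mul_one]

end Rows

/-! ## §2 Column side: `Δ′_a(U)·M_h = Δ′_{a,□}(U)·M_h` one stencil inside the near region, hence `hlocT` at `G′_□(U)` -/

section Columns

variable (q : ↥(cubes (toKT i).D.toDomains)) (par : SiteParY 𝔸 i)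

/-- ★ COLUMN AGREEMENT: `Δ′_a(U)·M_h = Δ′_{a,□}(U)·M_h` whenever every site whose `K(h)`-stencil meets `supp h` lies near □ — a row of either product at `z` reads
`h·Λ` on `stencil(z)` only, so it vanishes unless `z` is such a site, and on those rows the two operators agree (lit-balaban-p33's
`B9Cor36GpCubeLocLetter.cutMulY_deltaPrimeAY_cutMulY_eq'` at `χ := 1`, `U′ = Ṽ := U`).  Print: the transposed use of (3.88), `h_□G′_□Δ′_a h_□ = h_□²`, reads
these columns. [cite: Balaban1985BackgroundPropagators, (3.88) p.409, (3.24) p.394, p.410 l.14–15 («K(h) is semi-local»)] -/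
theorem deltaPrimeAY_mul_cutMulY_eq (U : CfgY 𝔸 i) (h : SiteY i → ℝ) (D : Finset (SiteY i))
    (hD : ∀ z w, w ∈ stencilY i z → h w ≠ 0 → z ∈ D) (hnear : ∀ z ∈ D, NearH q z.1) :
    deltaPrimeAY i par U * cutMulY h = deltaPrimeACubeY i q par U * cutMulY h := by
  have key := cutMulY_deltaPrimeAY_cutMulY_eq' i q par U U h (fun _ => (1 : ℝ)) D hD (fun _ _ => rfl) hnear (fun _ _ _ => rfl)
  rwa [cutMulY_one, one_mul] at key

open Classical in
/-- ★ the same with the row set left implicit: it suffices that `stencil(z) ∩ supp h ≠ ∅ ⇒ z ∈ NearH □`.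
[cite: Balaban1985BackgroundPropagators, (3.88) p.409, p.410 l.14–15] -/
theorem deltaPrimeAY_mul_cutMulY_eq' (U : CfgY 𝔸 i) (h : SiteY i → ℝ) (hh : ∀ z w, w ∈ stencilY i z → h w ≠ 0 → NearH q z.1) :
    deltaPrimeAY i par U * cutMulY h = deltaPrimeACubeY i q par U * cutMulY h := by
  refine deltaPrimeAY_mul_cutMulY_eq i q par U h (Finset.univ.filter fun z => ∃ w ∈ stencilY i z, h w ≠ 0) ?_ ?_
  · intro z w hw hne
    simp only [Finset.mem_filter, Finset.mem_univ, true_and]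
    exact ⟨w, hw, hne⟩
  · intro z hz
    simp only [Finset.mem_filter, Finset.mem_univ, true_and] at hz
    obtain ⟨w, hw, hne⟩ := hz
    exact hh z w hw hne

/-- ★★ **`hlocT` AT PRINT's `G′_□(U)`**: for every real cut-off `h` whose stencil-thickened support lies near □ and `Δ′_{a,□}(U)` invertible,
`M_h·G′_□(U)·Δ′_a(U)·M_h = M_h²` — the hypothesis `hlocT` of `B9Thm37TransposedCommutator.eq388T_hT` ∕ `B9Thm37GpTorusRegularFinal.eBlock_kernelFamilySInv_Gp_of_localInverse`
at `Oc □ := GpCubeY i □ par`, read at the member's own field. [cite: Balaban1985BackgroundPropagators, (3.87)–(3.88) p.409, p.408 l.35–p.409 l.5 (G′_□(U)), p.410 l.14–15] -/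
theorem cutMulY_GpCubeY_deltaPrimeAY_cutMulY {U : CfgY 𝔸 i} (hU : IsUnit (deltaPrimeACubeY i q par U))
    (h : SiteY i → ℝ) (hh : ∀ z w, w ∈ stencilY i z → h w ≠ 0 → NearH q z.1) :
    cutMulY h * GpCubeY i q par U * deltaPrimeAY i par U * cutMulY h = cutMulY h * cutMulY h := by
  rw [mul_assoc (cutMulY h * GpCubeY i q par U), deltaPrimeAY_mul_cutMulY_eq' i q par U h hh, ← mul_assoc,
    mul_assoc (cutMulY h) (GpCubeY i q par U) (deltaPrimeACubeY i q par U), GpCubeY_mul_deltaPrimeACubeY i q par U hU, mul_one]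

end Columns

/-! ## §3 At the partition of record `h_□ = hTY i □`: both laws from `IsUnit Δ′_{a,□}(U)` alone -/

section Record

variable (c : ↥(cubes i.D.toDomains)) (par : SiteParY 𝔸 i)

/-- one stencil around `supp h_□` is still near □ (lit-balaban's row set `D_□ = DthY i □ ⊂ NearH □`; `supp h_□ ⊂ NearH □` itself is the landed
`B9Cor36GCubeLocDefectTransfer.nearH_of_hTY_ne_zero`).
[cite: Balaban1985BackgroundPropagators, (3.88) p.409, p.410 l.14–15; Balaban1984PropagatorsII, (2.36) p.229] -/
theorem nearH_of_mem_stencilY_hTY {z w : SiteY i} (hw : w ∈ stencilY i z) (hz : hTY i c w ≠ 0) : NearH c z.1 :=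
  nearH_of_mem_DthY i c (mem_DthY i c hw hz)

/-- ★★★ **BOTH LOCAL-INVERSE LAWS OF PRINT's `G′_□(U)` AT THE PARTITION OF RECORD, FROM `IsUnit Δ′_{a,□}(U)` ALONE** (any site transporter `par`):
`h_□·Δ′_a(U)·G′_□(U)·h_□ = h_□² = h_□·G′_□(U)·Δ′_a(U)·h_□` — the per-cube binders `hloc`, `hlocT` of p21's
`B9Thm37GpTorusRegularFinal.eBlock_kernelFamilySInv_Gp_of_localInverse` at `Oc □ := GpCubeY i □ par`, letter-exact.
[cite: Balaban1985BackgroundPropagators, (3.87)–(3.88) p.409, p.408 l.35–p.409 l.5, Cor. 3.6 p.408] -/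
theorem localInverse_laws_hTY_GpCubeY {U : CfgY 𝔸 i} (hU : IsUnit (deltaPrimeACubeY i c par U)) :
    cutMulY (hTY i c) * deltaPrimeAY i par U * GpCubeY i c par U * cutMulY (hTY i c) = cutMulY (hTY i c) * cutMulY (hTY i c) ∧
    cutMulY (hTY i c) * GpCubeY i c par U * deltaPrimeAY i par U * cutMulY (hTY i c) = cutMulY (hTY i c) * cutMulY (hTY i c) :=
  ⟨cutMulY_deltaPrimeAY_GpCubeY_cutMulY i c par hU (hTY i c) fun _ hz => nearH_of_hTY_ne_zero i c hz,
    cutMulY_GpCubeY_deltaPrimeAY_cutMulY i c par hU (hTY i c) fun _ _ hw hz => nearH_of_mem_stencilY_hTY i c hw hz⟩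

end Record

/-! ## §4 (3.87)–(3.88), the transposed (3.88) and the fixed point (3.90) at the sequence letters -/

section Expansion

variable (par : SiteParY 𝔸 i) (U : CfgY 𝔸 i)

/-- ★★ (3.88) «Δ′_aG′₀ = I − Σ_□ K(h_□)G′_□h_□» AT PRINT's SEQUENCE LETTERS, for any real family `hf` with `Σ_c hf_c² = 1`, each `hf c` supported near its
cube `qc c`, every `Δ′_{a,□_c}(U)` invertible. [cite: Balaban1985BackgroundPropagators, (3.87)–(3.88) p.409] -/
theorem eq388_GpCubeY_family {ι : Type} [Fintype ι] (hf : ι → SiteY i → ℝ) (hsq : ∀ z, ∑ c, hf c z ^ 2 = 1)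
    (qc : ι → ↥(cubes (toKT i).D.toDomains)) (hh : ∀ c z, hf c z ≠ 0 → NearH (qc c) z.1)
    (hU : ∀ c, IsUnit (deltaPrimeACubeY i (qc c) par U)) :
    deltaPrimeAY i par U * (∑ c, cutMulY (hf c) * GpCubeY i (qc c) par U * cutMulY (hf c))
      = 1 - ∑ c, KhY i par (hf c) U * GpCubeY i (qc c) par U * cutMulY (hf c) :=
  eq388_deltaPrimeAY i par U hf hsq (fun c => GpCubeY i (qc c) par U)
    fun c => cutMulY_deltaPrimeAY_GpCubeY_cutMulY i (qc c) par (hU c) (hf c) (hh c)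

/-- ★★ THE TRANSPOSED (3.88) «(Σ_□ h_□G′_□h_□)·Δ′_a = 1 + Σ_□ h_□G′_□K(h_□)» AT PRINT's SEQUENCE LETTERS, for any real family `hf` with `Σ_c hf_c² = 1` whose
stencil-thickened supports lie near their cubes. [cite: Balaban1985BackgroundPropagators, (3.87)–(3.88) p.409, p.410 l.14–15] -/
theorem eq388T_GpCubeY_family {ι : Type} [Fintype ι] (hf : ι → SiteY i → ℝ) (hsq : ∀ z, ∑ c, hf c z ^ 2 = 1)
    (qc : ι → ↥(cubes (toKT i).D.toDomains)) (hh : ∀ c z w, w ∈ stencilY i z → hf c w ≠ 0 → NearH (qc c) z.1)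
    (hU : ∀ c, IsUnit (deltaPrimeACubeY i (qc c) par U)) :
    (∑ c, cutMulY (hf c) * GpCubeY i (qc c) par U * cutMulY (hf c)) * deltaPrimeAY i par U
      = 1 + ∑ c, cutMulY (hf c) * GpCubeY i (qc c) par U * KhY i par (hf c) U :=
  eq388T_sum (deltaPrimeAY i par U) (fun c => cutMulY (hf c)) (fun c => GpCubeY i (qc c) par U) (fun c => KhY i par (hf c) U)
    (fun c => deltaPrimeAY_mul_cutMulY i par (hf c) U)
    (fun c => cutMulY_GpCubeY_deltaPrimeAY_cutMulY i (qc c) par (hU c) (hf c) (hh c)) (sum_cutMulY_mul_self hf hsq)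

/-- ★★ **(3.87)–(3.88) AT THE PARTITION OF RECORD AND PRINT's `G′_□(U)`**: `Δ′_a(U)·Σ_□ h_□G′_□(U)h_□ = 1 − Σ_□ K(h_□)(U)G′_□(U)h_□` over the cubes of the member's
cover, under `∀ □, IsUnit Δ′_{a,□}(U)`. [cite: Balaban1985BackgroundPropagators, (3.87)–(3.88) p.409] -/
theorem eq388_GpCubeY (hU : ∀ c : ↥(cubes i.D.toDomains), IsUnit (deltaPrimeACubeY i c par U)) :
    deltaPrimeAY i par U * (∑ c, cutMulY (hTY i c) * GpCubeY i c par U * cutMulY (hTY i c))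
      = 1 - ∑ c, KhY i par (hTY i c) U * GpCubeY i c par U * cutMulY (hTY i c) :=
  eq388_hT i par U (fun c => GpCubeY i c par U) fun c => (localInverse_laws_hTY_GpCubeY i c par (hU c)).1

/-- ★★ **THE TRANSPOSED (3.88) AT THE PARTITION OF RECORD AND PRINT's `G′_□(U)`**: `(Σ_□ h_□G′_□(U)h_□)·Δ′_a(U) = 1 + Σ_□ h_□G′_□(U)K(h_□)(U)`.
[cite: Balaban1985BackgroundPropagators, (3.87)–(3.88) p.409] -/
theorem eq388T_GpCubeY (hU : ∀ c : ↥(cubes i.D.toDomains), IsUnit (deltaPrimeACubeY i c par U)) :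
    (∑ c, cutMulY (hTY i c) * GpCubeY i c par U * cutMulY (hTY i c)) * deltaPrimeAY i par U
      = 1 + ∑ c, cutMulY (hTY i c) * GpCubeY i c par U * KhY i par (hTY i c) U :=
  eq388T_hT i par U (fun c => GpCubeY i c par U) fun c => (localInverse_laws_hTY_GpCubeY i c par (hU c)).2

/-- ★ **THE FIXED POINT (3.90) AT PRINT's `G′_□(U)`**: every left inverse `G′` of `Δ′_a(U)` satisfies `G′ = Σ_□ h_□G′_□(U)h_□ + G′·Σ_□ K(h_□)(U)G′_□(U)h_□`
(«G′ = G′₀(I − R′)⁻¹ = G′₀ Σ_n R′ⁿ» read without inverting `I − R′`). [cite: Balaban1985BackgroundPropagators, (3.90) p.409] -/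
theorem fixedPoint388_GpCubeY (hU : ∀ c : ↥(cubes i.D.toDomains), IsUnit (deltaPrimeACubeY i c par U))
    {G' : Module.End ℂ (SiteY i → 𝔸)} (hinv : G' * deltaPrimeAY i par U = 1) :
    G' = (∑ c, cutMulY (hTY i c) * GpCubeY i c par U * cutMulY (hTY i c)) +
      G' * ∑ c, KhY i par (hTY i c) U * GpCubeY i c par U * cutMulY (hTY i c) :=
  fixedPoint388_hT i par U (fun c => GpCubeY i c par U) (fun c => (localInverse_laws_hTY_GpCubeY i c par (hU c)).1) hinv

/-- ★ **(3.90) FOR def-Y's MEMBER INVERSE `G′(U) = GpY i par U`** (`= Δ′_a(U)⁻¹` where it is a unit): `G′(U) = Σ_□ h_□G′_□(U)h_□ + G′(U)·R′(U)` with print's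
`R′ = Σ_□ K(h_□)G′_□h_□` at the sequence letters, under `IsUnit Δ′_a(U)` and `∀ □, IsUnit Δ′_{a,□}(U)`.
[cite: Balaban1985BackgroundPropagators, (3.90) p.409, (3.25) p.394 («G′ = (Δ′_a)⁻¹»)] -/
theorem GpY_eq_fixedPoint388_GpCubeY (hUm : IsUnit (deltaPrimeAY i par U))
    (hU : ∀ c : ↥(cubes i.D.toDomains), IsUnit (deltaPrimeACubeY i c par U)) :
    GpY i par U = (∑ c, cutMulY (hTY i c) * GpCubeY i c par U * cutMulY (hTY i c)) +
      GpY i par U * ∑ c, KhY i par (hTY i c) U * GpCubeY i c par U * cutMulY (hTY i c) :=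
  fixedPoint388_GpCubeY i par U hU (GpY_mul_deltaPrimeAY i par U hUm)

end Expansion

end Literature.MathematicalPhysics.QuantumFieldTheory.Balaban1983to89.Node00.OpsYLocalInverseSeq

end
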